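import Summits.QuantumFields.YangMills.Theorems.UnitScaleTiltProp7SolutionHessianSupOfRegPr
import Summits.QuantumFields.YangMills.Theorems.UnitScaleTiltProp7StoreyHValueRows
import Summits.QuantumFields.YangMills.Theorems.UnitScaleTiltProp7OneFormGradientSupNabla
import HarnessLib

/-!
# Route `UnitScaleTilt`, crux K1 «MinimiserStabilityRegPr» (stmt-QuantumFields-19200), EX row (5) `h3` (STOREY H), H-ROAD brick **H8 (★p1 g28 CHAIR WORDS №46∕№48):
# THE (115)-READING — the 𝔊-door's third-word gradient letter `h3` FROM H7's sup→sup covariant Hessian row, H1+H3's value rows and the ½-Hölder letter H2**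

The FrakG-door ✓`Prop7FrakGOneSupNormOfWords.norm_frakGfR_le_of_words` (and the (∇1)-KNIT ✓`Prop7GreenOneGradientRowOfLetters`) display ONE second-order letter of print's
third word of `𝔊 = (115)`: `h3 : ∀ A, ‖∇^η_{(115)}(toL2⁻¹(D_{U₀}λ₁(A)) ∘ bondEquiv⁻¹)‖ ≤ M₃·‖A‖`, `λ₁(A) := G′ᴾ_a(R_S(D*_{U₀}(G_{Δx}(toL2 A))))` — STOREY H.  The H-road
(LIT-LOCATE #56, chair WORD №46) typed it as bricks: H4–H6 ✓`Prop7CurvedMemberLocalHessian` (the local covariant Hessian row), H7 ✓`Prop7SolutionHessianSupOfRegPr.norm_covGradT_DL2_le_of_holderLetters`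
(sup→sup: `‖covGradT η (bgUnits U₀) (toL2⁻¹(D_{U₀}u)) μ ν x‖ ≤ 2·M₀(ε₀; M_u, N_ω, H_ω, M_w)` for ANY `Δ^η_{U₀}u = ω`), H1+H3 ✓`Prop7StoreyHValueRows.storeyH_value_rows`
(the sups `M_u, N_ω, M_w` of `λ₁(A), ω₁(A), D_{U₀}λ₁(A)`, linear in `‖A‖`, from the letters (Div1) `hD1`, `hR`, (c1) `hc1`, (c2) `hc2`), H2 (the covariant ½-Hölder row `H_ω` of
`ω₁(A)`, px19 g15 — DISPLAYED here as the letter `hHω`, H7's binder text VERBATIM at `ω := ω₁(A)`, `Hω := C_{Hω}·‖A‖`).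

THIS FILE (H8) is the (115)-reading that closes the road's shape: ★★★`h3_of_holderLetters` — under `RegPr F n K ε₀ U₀` (`0 < ε₀ ≤ 1`), `0 ≤ a`, the four value
letters, the Hölder letter, H7's no-wrap room and absorption margin: **the `h3` binder text VERBATIM** (✓p769750 :157 at `Δx := DeltaOneP … a T_J`; the Π-door's at
`Δx := DeltaPiSlotP … a`) with the CLOSED constant `M₃ := 2·M₀(ε₀; √2·C₁·BD₁, CR·√2·BD₁, C_{Hω}, √2·C₂·BD₁)` (H7's `M₀` is linear-homogeneous in its four letters, so
`2·M₀(letters·‖A‖) = M₃·‖A‖` by `ring`).  PROOF = ✓`Prop7ChainPotentialHessianRow.hessRow_chain_of_letters` §3's pattern: per component `(μ, ν, x)` H7 at `u := λ₁(A)`,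
`ω := ω₁(A)`, `hEq :=` ✓`covLapSite_lambda₁_eq_omega₁`, the rows from ✓`storeyH_value_rows`; then the (115) dictionary ✓`nabla115_bgOfCfg_eq_covGradT` and the Pi sup norm
(`pi_norm_le_iff_of_nonneg`).  SLOT-GENERIC (`Δx` abstract, as H1+H3).

HYP-SAT (★★OWNER RULING №42).  `RegPr`-class + sup∕Hölder letters between displayed terms (finite maxima at fixed data; (Div1)∕`hR`∕(c1)∕(c2) inhabited by the landed families
✓`valueDiv_GT_…_sup_family`∕W4∕✓`hc1_hc3_sup_family`∕✓`hc2_sup_family`; `hHω` = H2's deliverable) + the room∕margin numerals; at `A = 0` every letter and the conclusion read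
`0 ≤ 0` — non-vacuous, no `Prop` placeholder.  HONEST SCOPE: a reading∕assembly of landed bricks; the ½-Hölder row H2 is a LETTER here; nothing of H2, `norm_G`, the EX display,
EX `stub_existenceMinimalOrbit`, `MinimiserStabilityRegPr` (19200) or R3 is proved; rung R3 = SU(2) YM₃ on T³ — NOT d = 4, NOT infinite volume, NOT a mass gap, NOT Clay.
px17 g12 (prover-ym3-torus-px17-g12-0).  Def-free; no `sorry`; default heartbeats.

References: T. Bałaban, CMP **99** (1985) 389–434 [Balaban1985BackgroundPropagators] (Thm 3.1 (3.42)–(3.44) pp.397–398, (3.21)–(3.25) p.394, (3.117)–(3.122) pp.419–420,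
Thm 3.13 p.426); CMP **102** (1985) 277–309 [Balaban1985Variational] ((19) p.281, (115)–(117) pp.294–295).
-/

set_option autoImplicit false

noncomputable section

open scoped BigOperators Matrix.Norms.L2Operator InnerProductSpace ComplexConjugate

namespace Summit.QuantumFields.YangMills.Theorems.Prop7StoreyHGradientRow

open Literature.MathematicalPhysics.QuantumFieldTheory.Balaban1983to89
open Literature.MathematicalPhysics.QuantumFieldTheory.Balaban1983to89.T3ContinuumYM3Torus
open T3PrintedRegularMinimiser (RegPr)
open T3SectALandauChart (eta eta_pos covGradT bgUnits)
open B10Eq27TorusAxialLog (axialT)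
open B4Sect5Torus (TSite tdist)
open B9SectCLatticeCarrier (Bond)
open B9Eq311L2Pairing (WL2)
open B11Eq111FrakG (nabla115)
open B11Eq103H1Complex (SiteL2K BondL2K)
open Summit.QuantumFields.YangMills.Theorems.Prop7SectET3Transport (periodsT3 siteEquiv bondEquiv bgOfCfg)
open Summit.QuantumFields.YangMills.Theorems.Prop7SectET3HilbertLetters (W₂ toL2 toL2S DL2 DstarL2 covLapSite)
open Summit.QuantumFields.YangMills.Theorems.Prop7SectET3GaugeProjector (RS)
open Summit.QuantumFields.YangMills.Theorems.Prop7SectET3CurvedPropagators (GT)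
open Summit.QuantumFields.YangMills.Theorems.Prop7SectET3DeltaPiPInv (GprimeP)
open Summit.QuantumFields.YangMills.Theorems.Prop7CurvedMemberLocalHessian (exists_curved_localHessian)
open Summit.QuantumFields.YangMills.Theorems.AxialGaugeChartGlue (norm_bgOfCfg_axialT_sub_le)
open Summit.QuantumFields.YangMills.Theorems.Prop7SolutionHessianSupOfRegPr (norm_covGradT_DL2_le_of_holderLetters)
open Summit.QuantumFields.YangMills.Theorems.Prop7StoreyHValueRows (covLapSite_lambda₁_eq_omega₁ storeyH_value_rows)
open Summit.QuantumFields.YangMills.Theorems.Prop7OneFormGradientSupNabla (nabla115_bgOfCfg_eq_covGradT)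

variable (F : T3Family) {n K : ℕ} (h : n ≤ K) (c₀ cB : ℝ) [Fact (0 < c₀)] [Fact (0 < cB)]
  {a : ℝ} (Δx : GaugeField (F.P K) 0 (Matrix.specialUnitaryGroup (Fin 2) ℂ) → (BondL2K ℂ 3 (periodsT3 F K) c₀ W₂ →ₗ[ℂ] BondL2K ℂ 3 (periodsT3 F K) c₀ W₂))
  {ε₀ : ℝ} (hε₀ : 0 < ε₀) (hε1 : ε₀ ≤ 1)
  (U₀ : GaugeField (F.P K) 0 (Matrix.specialUnitaryGroup (Fin 2) ℂ)) (hreg : RegPr F n K ε₀ U₀)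

/-! ## §1 ★★★ H8: the `h3` letter from H7 + H1∕H3 + H2 -/

include hε₀ hε1 hreg in
/-- ★★★ **H8 — STOREY H's `h3` FROM THE H-ROAD's BRICKS.**  At a printed-regular background (`RegPr F n K ε₀ U₀`, `0 < ε₀ ≤ 1`), coupling `0 ≤ a`, ANY Hessian slot `Δx`,
with the value letters (Div1) `hD1` (divergence sup row of `G_{Δx}`), `hR` (the `R_S` fibre-sup letter), (c1) `hc1`, (c2) `hc2` (H1+H3's texts VERBATIM), the covariant
½-Hölder letter `hHω` of `ω₁(A) := R_S(D*_{U₀}(G_{Δx}(toL2 A)))` in the local axial gauges (H7's `hHω` binder VERBATIM at `ω := ω₁(A)`, `Hω := C_{Hω}·‖A‖` — H2's deliverable),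
H7's no-wrap room and absorption margin:
`∀ A, ‖∇^η_{(115)}(toL2⁻¹(D_{U₀}(G′ᴾ_a(ω₁(A)))) ∘ bondEquiv⁻¹)‖ ≤ M₃·‖A‖` — the 𝔊-door's `h3` binder text, `M₃ = 2·M₀(ε₀; √2C₁BD₁, CR√2BD₁, C_{Hω}, √2C₂BD₁)` closed.
PROOF: per component H7 ✓`norm_covGradT_DL2_le_of_holderLetters` at `u := λ₁(A)`, `ω := ω₁(A)` (`Δ^ηλ₁ = ω₁` ✓`covLapSite_lambda₁_eq_omega₁`), rows ✓`storeyH_value_rows`;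
the (115) dictionary ✓`nabla115_bgOfCfg_eq_covGradT`; Pi sup norm.
[cite: Balaban1985BackgroundPropagators, Thm 3.1 (3.42)–(3.44) pp.397–398, (3.21)–(3.25) p.394, (3.117)–(3.122) pp.419–420, Thm 3.13 p.426; Balaban1985Variational, (19) p.281, (115)–(117) pp.294–295] -/
theorem h3_of_holderLetters (ha : 0 ≤ a) {BD₁ CR C₁ C₂ CHω : ℝ} (hBD₁ : 0 ≤ BD₁) (hCR : 0 ≤ CR) (hC₁ : 0 ≤ C₁) (hC₂ : 0 ≤ C₂) (hCHω : 0 ≤ CHω)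
    (hD1 : ∀ (A : PBond (F.P K) 0 → Matrix (Fin 2) (Fin 2) ℂ) (x : Site (F.P K) 0),
      ‖(toL2S F K c₀).symm (DstarL2 F n K c₀ U₀ (GT F n K h c₀ cB a Δx U₀ (toL2 F K c₀ A))) x‖ ≤ BD₁ * ‖A‖)
    (hR : ∀ (g : SiteL2K ℂ 3 (periodsT3 F K) c₀ W₂) (Gb : ℝ), (∀ y, ‖WL2.equiv ℂ _ W₂ g y‖ ≤ Gb) → ∀ y, ‖WL2.equiv ℂ _ W₂ (RS F n K h c₀ cB U₀ g) y‖ ≤ CR * Gb)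
    (hc1 : ∀ (v : Site (F.P K) 0 → Matrix (Fin 2) (Fin 2) ℂ) (m : ℝ), (∀ x, ‖v x‖ ≤ m) →
      ∀ x, ‖(toL2S F K c₀).symm (GprimeP F n K h c₀ cB a U₀ (RS F n K h c₀ cB U₀ (toL2S F K c₀ v))) x‖ ≤ C₁ * m)
    (hc2 : ∀ (v : Site (F.P K) 0 → Matrix (Fin 2) (Fin 2) ℂ) (m : ℝ), (∀ x, ‖v x‖ ≤ m) →
      ∀ b, ‖(toL2 F K c₀).symm (DL2 F n K c₀ U₀ (GprimeP F n K h c₀ cB a U₀ (RS F n K h c₀ cB U₀ (toL2S F K c₀ v)))) b‖ ≤ C₂ * m)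
    (hHω : ∀ (A : PBond (F.P K) 0 → Matrix (Fin 2) (Fin 2) ℂ) (c : Site (F.P K) 0) (y y' : TSite 3 (periodsT3 F K)),
      tdist (periodsT3 F K) (siteEquiv F K c) y ≤ 4 * (F.L : ℝ) ^ (K - n) + 1 → tdist (periodsT3 F K) (siteEquiv F K c) y' ≤ 4 * (F.L : ℝ) ^ (K - n) + 1 →
      ‖WL2.equiv ℂ (fun _ : TSite 3 (periodsT3 F K) => c₀) W₂
            (toL2S F K c₀ (fun z => ((axialT U₀ c z : Matrix.specialUnitaryGroup (Fin 2) ℂ) : Matrix (Fin 2) (Fin 2) ℂ) *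
              (toL2S F K c₀).symm (RS F n K h c₀ cB U₀ (DstarL2 F n K c₀ U₀ (GT F n K h c₀ cB a Δx U₀ (toL2 F K c₀ A)))) z
              * star ((axialT U₀ c z : Matrix.specialUnitaryGroup (Fin 2) ℂ) : Matrix (Fin 2) (Fin 2) ℂ))) y'
          - WL2.equiv ℂ (fun _ : TSite 3 (periodsT3 F K) => c₀) W₂
            (toL2S F K c₀ (fun z => ((axialT U₀ c z : Matrix.specialUnitaryGroup (Fin 2) ℂ) : Matrix (Fin 2) (Fin 2) ℂ) *
              (toL2S F K c₀).symm (RS F n K h c₀ cB U₀ (DstarL2 F n K c₀ U₀ (GT F n K h c₀ cB a Δx U₀ (toL2 F K c₀ A)))) z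
              * star ((axialT U₀ c z : Matrix.specialUnitaryGroup (Fin 2) ℂ) : Matrix (Fin 2) (Fin 2) ℂ))) y‖
        ≤ (CHω * ‖A‖) * (tdist (periodsT3 F K) y y' / ((F.L : ℝ) ^ (K - n))) ^ ((1 : ℝ) / 2))
    (hroom : 2 * (12 * F.L ^ (K - n) + 5) ≤ (F.P K).sitesPerDir 0)
    (hsmall : exists_curved_localHessian.choose * ((48 * ε₀) * (6 * Real.sqrt 2 * Real.sqrt 10 + 6 * Real.sqrt 2)) ≤ 1 / 2) :
    ∀ A : PBond (F.P K) 0 → Matrix (Fin 2) (Fin 2) ℂ,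
      ‖nabla115 (((F.L : ℝ)⁻¹) ^ (K - n)) (bgOfCfg F K U₀)
          (fun q : Bond 3 (periodsT3 F K) => (toL2 F K c₀).symm (DL2 F n K c₀ U₀ (GprimeP F n K h c₀ cB a U₀ (RS F n K h c₀ cB U₀
            (DstarL2 F n K c₀ U₀ (GT F n K h c₀ cB a Δx U₀ (toL2 F K c₀ A)))))) ((bondEquiv F K).symm q))‖
        ≤ (2 * (exists_curved_localHessian.choose *
            ((Real.sqrt 2 * (C₂ * BD₁)) + ((2 * Real.sqrt 2 * (4 * ε₀ * (3 + 2457 * norm_bgOfCfg_axialT_sub_le.choose)) * (CR * (Real.sqrt 2 * BD₁)) + CHω)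
              + 2 * Real.sqrt 2 * ((4 * ε₀ * (3 + 2457 * norm_bgOfCfg_axialT_sub_le.choose)) * (Real.sqrt 2 * (C₂ * BD₁)) + (48 * ε₀) * (3 * Real.sqrt 10 * (2 * Real.sqrt 2 * (48 * ε₀) * (Real.sqrt 2 * (C₂ * BD₁))))))
            + (6 * Real.sqrt 2 * (48 * ε₀) * ((CR * (Real.sqrt 2 * BD₁)) + 2 * Real.sqrt 2 * (48 * ε₀) * (Real.sqrt 2 * (C₂ * BD₁)) + 2 * Real.sqrt 2 * (48 * ε₀) * (Real.sqrt 2 * (C₂ * BD₁))) + (Real.sqrt 2 * (C₂ * BD₁))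
              + Real.sqrt 2 * ((2 * ε₀ + 24 * ε₀ ^ 2) * (Real.sqrt 2 * (C₁ * BD₁)) + 12 * ε₀ * (Real.sqrt 2 * (C₂ * BD₁)))))
          + 2 * Real.sqrt 2 * (48 * ε₀) * (Real.sqrt 2 * (C₂ * BD₁)))) * ‖A‖ := by
  intro A
  have hA : 0 ≤ ‖A‖ := norm_nonneg _
  have hCH0 : 0 ≤ exists_curved_localHessian.choose := exists_curved_localHessian.choose_spec.1
  obtain ⟨hC0, -⟩ := norm_bgOfCfg_axialT_sub_le.choose_spec
  -- H1 + H3: the three value rows of `ω₁(A)`, `λ₁(A)`, `D_{U₀}λ₁(A)` (fibre currency)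
  obtain ⟨hN, -, hMu, -, hMw⟩ := storeyH_value_rows F h c₀ cB Δx U₀ hD1 hR hc1 hc2 A
  -- H7 per component, at `u := λ₁(A)`, `ω := ω₁(A)`
  have hcomp : ∀ (μ ν : Fin (F.P K).d) (x : Site (F.P K) 0),
      ‖covGradT (eta F n K) (bgUnits F K U₀) ((toL2 F K c₀).symm (DL2 F n K c₀ U₀ (GprimeP F n K h c₀ cB a U₀ (RS F n K h c₀ cB U₀
        (DstarL2 F n K c₀ U₀ (GT F n K h c₀ cB a Δx U₀ (toL2 F K c₀ A))))))) μ ν x‖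
        ≤ 2 * (exists_curved_localHessian.choose *
            (((Real.sqrt 2 * (C₂ * BD₁)) * ‖A‖) + ((2 * Real.sqrt 2 * (4 * ε₀ * (3 + 2457 * norm_bgOfCfg_axialT_sub_le.choose)) * ((CR * (Real.sqrt 2 * BD₁)) * ‖A‖) + (CHω * ‖A‖))
              + 2 * Real.sqrt 2 * ((4 * ε₀ * (3 + 2457 * norm_bgOfCfg_axialT_sub_le.choose)) * ((Real.sqrt 2 * (C₂ * BD₁)) * ‖A‖) + (48 * ε₀) * (3 * Real.sqrt 10 * (2 * Real.sqrt 2 * (48 * ε₀) * ((Real.sqrt 2 * (C₂ * BD₁)) * ‖A‖)))))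
            + (6 * Real.sqrt 2 * (48 * ε₀) * (((CR * (Real.sqrt 2 * BD₁)) * ‖A‖) + 2 * Real.sqrt 2 * (48 * ε₀) * ((Real.sqrt 2 * (C₂ * BD₁)) * ‖A‖) + 2 * Real.sqrt 2 * (48 * ε₀) * ((Real.sqrt 2 * (C₂ * BD₁)) * ‖A‖)) + ((Real.sqrt 2 * (C₂ * BD₁)) * ‖A‖)
              + Real.sqrt 2 * ((2 * ε₀ + 24 * ε₀ ^ 2) * ((Real.sqrt 2 * (C₁ * BD₁)) * ‖A‖) + 12 * ε₀ * ((Real.sqrt 2 * (C₂ * BD₁)) * ‖A‖))))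
          + 2 * Real.sqrt 2 * (48 * ε₀) * ((Real.sqrt 2 * (C₂ * BD₁)) * ‖A‖)) :=
    fun μ ν x => norm_covGradT_DL2_le_of_holderLetters F n K c₀ hε₀ hε1 U₀ hreg _ _ (covLapSite_lambda₁_eq_omega₁ F h c₀ cB Δx U₀ ha (toL2 F K c₀ A))
      (by positivity) (by positivity) (by positivity) (by positivity) hMu hN hMw (hHω A) hroom hsmall μ ν x
  -- the closed constant, and its linear reading
  set B : ℝ := 2 * (exists_curved_localHessian.choose *
            ((Real.sqrt 2 * (C₂ * BD₁)) + ((2 * Real.sqrt 2 * (4 * ε₀ * (3 + 2457 * norm_bgOfCfg_axialT_sub_le.choose)) * (CR * (Real.sqrt 2 * BD₁)) + CHω)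
              + 2 * Real.sqrt 2 * ((4 * ε₀ * (3 + 2457 * norm_bgOfCfg_axialT_sub_le.choose)) * (Real.sqrt 2 * (C₂ * BD₁)) + (48 * ε₀) * (3 * Real.sqrt 10 * (2 * Real.sqrt 2 * (48 * ε₀) * (Real.sqrt 2 * (C₂ * BD₁))))))
            + (6 * Real.sqrt 2 * (48 * ε₀) * ((CR * (Real.sqrt 2 * BD₁)) + 2 * Real.sqrt 2 * (48 * ε₀) * (Real.sqrt 2 * (C₂ * BD₁)) + 2 * Real.sqrt 2 * (48 * ε₀) * (Real.sqrt 2 * (C₂ * BD₁))) + (Real.sqrt 2 * (C₂ * BD₁))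
              + Real.sqrt 2 * ((2 * ε₀ + 24 * ε₀ ^ 2) * (Real.sqrt 2 * (C₁ * BD₁)) + 12 * ε₀ * (Real.sqrt 2 * (C₂ * BD₁)))))
          + 2 * Real.sqrt 2 * (48 * ε₀) * (Real.sqrt 2 * (C₂ * BD₁))) with hBdef
  have hB : 0 ≤ B := by have := hε₀.le; positivity
  have hBA : 0 ≤ B * ‖A‖ := mul_nonneg hB hA
  have hlin : 2 * (exists_curved_localHessian.choose *
            (((Real.sqrt 2 * (C₂ * BD₁)) * ‖A‖) + ((2 * Real.sqrt 2 * (4 * ε₀ * (3 + 2457 * norm_bgOfCfg_axialT_sub_le.choose)) * ((CR * (Real.sqrt 2 * BD₁)) * ‖A‖) + (CHω * ‖A‖))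
              + 2 * Real.sqrt 2 * ((4 * ε₀ * (3 + 2457 * norm_bgOfCfg_axialT_sub_le.choose)) * ((Real.sqrt 2 * (C₂ * BD₁)) * ‖A‖) + (48 * ε₀) * (3 * Real.sqrt 10 * (2 * Real.sqrt 2 * (48 * ε₀) * ((Real.sqrt 2 * (C₂ * BD₁)) * ‖A‖)))))
            + (6 * Real.sqrt 2 * (48 * ε₀) * (((CR * (Real.sqrt 2 * BD₁)) * ‖A‖) + 2 * Real.sqrt 2 * (48 * ε₀) * ((Real.sqrt 2 * (C₂ * BD₁)) * ‖A‖) + 2 * Real.sqrt 2 * (48 * ε₀) * ((Real.sqrt 2 * (C₂ * BD₁)) * ‖A‖)) + ((Real.sqrt 2 * (C₂ * BD₁)) * ‖A‖)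
              + Real.sqrt 2 * ((2 * ε₀ + 24 * ε₀ ^ 2) * ((Real.sqrt 2 * (C₁ * BD₁)) * ‖A‖) + 12 * ε₀ * ((Real.sqrt 2 * (C₂ * BD₁)) * ‖A‖))))
          + 2 * Real.sqrt 2 * (48 * ε₀) * ((Real.sqrt 2 * (C₂ * BD₁)) * ‖A‖)) = B * ‖A‖ := by
    rw [hBdef]; ring
  refine (pi_norm_le_iff_of_nonneg hBA).2 fun qν => ?_
  obtain ⟨q, ν⟩ := qν
  obtain ⟨b, rfl⟩ := (bondEquiv F K).surjective q
  obtain ⟨x, μ⟩ := b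
  rw [show (((F.L : ℝ)⁻¹) ^ (K - n)) = eta F n K from rfl, nabla115_bgOfCfg_eq_covGradT F c₀ U₀, ← hlin]
  exact hcomp μ ν x

end Summit.QuantumFields.YangMills.Theorems.Prop7StoreyHGradientRow

end
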